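/-
Origin: expansion seat `planner-pub-hodgecm-mc-axioms-1-g14-0`, handover #W52 2026-08-20T15:53:55Z md5 b69e8eaaa537 (PKG c91831875936 → b69e8eaaa537; 294 l.; MECHANICAL (iib-R) rewrite v3.1 of the PKG file as it stands (24 token edits; rules R1x1+R2x1+RX[h₂']x4+R3x1+R8x17)) (`HOME/mc/pub-hodgecm-mc-axioms-1-g14/revendor/kit-r55/stage55/HodgeCM/Model/PerLOfCanonical.lean`, md5 b69e8eaaa537, 294 lines);
landed by the gen-22 packager (p-g22) in gate run 55 REPLACES the earlier landed copy of `HodgeCM/Model/PerLOfCanonical.lean` (seat copy carried the packager Origin header of an earlier run (stripped)).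
-/
/-
Copyright: pub-hodgecm formalisation cell (harness21, 2026). New file (not vendored).
CONSTRUCTION seat `planner-pub-hodgecm-mc-axioms-3-g11-0` (unit pub-hodgecm-mc-axioms-3-g11, universe /
instance-assembly lane), 2026-08-20 — (c̄) of the lead's RULING (ORIENT-h)/(TWIST-2) (STATUS l.12517 (R3)):
the statement-level lemma `PerL_of_perL_canonical` for the MODEL universe. Kernel only: 0 records,
0 `Prop`-valued hypotheses, no analytic brick, no vendored change; MODEL-N ±0.
-/
import Summits.HodgeConjecture.HodgeCM.Model.Universe
import Summits.HodgeConjecture.HodgeCM.CM.ReflexInflate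

/-!
# `PerL` from `PerL` at canonical representatives (model universe)

`Universe.PerLCanonical U` is the text of `U.PerL` (`Geometry/Statements.lean`) verbatim with ONE extra
hypothesis `(InfinitePlace.mk ι₁).embedding = ι₁` (the embedding is Mathlib's chosen representative of its
place).  For the model universe `universeOf hHD hI hU h₃` (hence `picardCMUniverse …`) we prove
`PerLCanonical → PerL` WITHOUT conjugate varieties: for a `PerL` instance `(K, L, j, φ, ι₀, t)` with `ι₀`
off the representative, the representative is `ι₁ := conjugate ι₀`; with `j′ := c_L ∘ j` one has
`ι₁ ∘ j′ = ι₀ ∘ j = φ 0` (same `K`, frame, types and eigen-character), and the source surface is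
RE-PRESENTED: the hermitian space `⟨Hmᵀ⟩` at `ι₀` with the `c_L`-conjugate level has the SAME Picard code as
`⟨Hm⟩` at `ι₁`, so the model's `U.pms` (which forgets the presentation) is the same element of `Var`, and
`PeriodNV` transports along that equality with targets, eigen-lines and period literally unchanged.
-/

noncomputable section

open scoped Matrix ComplexOrder
open NumberField NumberField.InfinitePlace NumberField.ComplexEmbedding
open Literature.AlgebraicGeometry.Motives (CMType)
open Literature.AlgebraicGeometry.ShimuraVarieties
open Literature.NumberTheory.Automorphic.PicardCM

namespace HodgeCM

open CMTypeOps (conjAut apply_conjAut comp_conjAut conjAut_conjAut)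

/-! ### The statement -/

namespace Universe

variable (U : Universe)

/-- **`PerL` at canonical representatives**: `U.PerL` verbatim, with the extra hypothesis that `ι₁` is
Mathlib's representative `(InfinitePlace.mk ι₁).embedding` of its place. -/
def PerLCanonical : Prop :=
  ∀ (K L : CMField) (j : K →+* L), IsNormalClosure ℚ K L →
    Module.finrank ℚ K = 6 → (Module.finrank ℚ L = 24 ∨ Module.finrank ℚ L = 48) →
    ∀ (φ : Fin 3 → (K →+* ℂ)), IsFrame φ →
    ∀ (ι₁ : L →+* ℂ), ι₁.comp j = φ 0 → (InfinitePlace.mk ι₁).embedding = ι₁ →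
    ∀ (t : Fin 4 → CMType K), IsPerLTypes φ t →
      ∃ V : HermSpace3 L ι₁, U.PeriodNV ι₁ V K t (φ 0)

/-- The trivial direction. -/
theorem perLCanonical_of_perL (h : U.PerL) : U.PerLCanonical :=
  fun K L j hN h6 h24 φ hφ ι₁ hι _ t ht ↦ h K L j hN h6 h24 φ hφ ι₁ hι t ht

/-- **`PerL44` at canonical representatives**: `U.PerL44` (Thm 4.4 as proved, `∀ V ∃ Γ`) verbatim with the same
extra hypothesis `(InfinitePlace.mk ι₁).embedding = ι₁` — the guard twin an oriented core proves first. -/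
def PerL44Canonical : Prop :=
  ∀ (K L : CMField) (j : K →+* L), IsNormalClosure ℚ K L →
    Module.finrank ℚ K = 6 → (Module.finrank ℚ L = 24 ∨ Module.finrank ℚ L = 48) →
    ∀ (φ : Fin 3 → (K →+* ℂ)), IsFrame φ →
    ∀ (ι₁ : L →+* ℂ), ι₁.comp j = φ 0 → (InfinitePlace.mk ι₁).embedding = ι₁ →
    ∀ (t : Fin 4 → CMType K), IsPerLTypes φ t →
      ∀ V : HermSpace3 L ι₁, U.PeriodNV ι₁ V K t (φ 0)

/-- The trivial direction. -/
theorem perL44Canonical_of_perL44 (h : U.PerL44) : U.PerL44Canonical :=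
  fun K L j hN h6 h24 φ hφ ι₁ hι _ t ht V ↦ h K L j hN h6 h24 φ hφ ι₁ hι t ht V

/-- `PerLCanonical` from `PerL44Canonical`: pick any hermitian space (Landherr) — `Assembly.perL_of_perL44`
with one more `intro`. -/
theorem perLCanonical_of_perL44Canonical (hL : LandherrExists) (h44 : U.PerL44Canonical) :
    U.PerLCanonical := by
  intro K L j hN hK hdeg φ hφ ι₁ hι hrep t ht
  obtain ⟨V⟩ := hL L ι₁
  exact ⟨V, h44 K L j hN hK hdeg φ hφ ι₁ hι hrep t ht V⟩

/-- `PeriodNV` transports along an equality of the source varieties (targets, eigen-lines and the period are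
untouched). -/
theorem periodNV_of_pms_eq {L K : CMField} {ι₀ ι₁ : L →+* ℂ} {V₀ : HermSpace3 L ι₀} {V₁ : HermSpace3 L ι₁}
    (Γ₀ : Level V₀) (Γ₁ : Level V₁) (hX : U.pms L ι₀ V₀ Γ₀ = U.pms L ι₁ V₁ Γ₁)
    {Ψ : Fin 4 → CMType K} {σ : K →+* ℂ}
    (h : ∃ (F : (i : Fin 4) → U.Mor (U.pms L ι₁ V₁ Γ₁) (U.cmAV K (Ψ i)))
      (α : (i : Fin 4) → U.CohC (U.cmAV K (Ψ i)) 1),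
      (∀ i, α i ∈ U.alphaLine K (Ψ i) σ) ∧
        U.period (U.pms L ι₁ V₁ Γ₁) (fun i => U.pullC (F i) 1 (α i)) ≠ 0) :
    U.PeriodNV ι₀ V₀ K Ψ σ := by
  generalize U.pms L ι₁ V₁ Γ₁ = X₁ at h hX
  subst hX
  obtain ⟨F, α, hα, hp⟩ := h
  exact ⟨Γ₀, F, α, hα, hp⟩

end Universe

/-! ### Re-presentation of hermitian data at the conjugate embedding -/

namespace HermSpace3

variable {L : CMField} {ι₀ ι₁ : L →+* ℂ}

/-- (Ported verbatim from the HodgeCMPerL package; no docstring in the source.) -/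
theorem apply_transpose_eq (V : HermSpace3 L ι₁) (h : conjugate ι₀ = ι₁) (i j : Fin 3) :
    ι₀ (V.Hm j i) = ι₁ (V.Hm i j) := by
  subst h
  rw [← V.isHermitian i j, embedding_conjRingHomK]
  rfl

/-- **The transposed space at the conjugate embedding**: Gram matrix `Hmᵀ`, presented at `ι₀` with
`conjugate ι₀ = ι₁`; `(Hmᵀ)^{ι₀} = Hm^{ι₁}` entrywise, so the Sylvester witness is the same, and positivity off
the place is `PosDef.transpose`. -/
def transposeAt (V : HermSpace3 L ι₁) (ι₀ : L →+* ℂ) (h : conjugate ι₀ = ι₁) : HermSpace3 L ι₀ where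
  Hm := V.Hmᵀ
  isHermitian i j := by
    rw [Matrix.transpose_apply, Matrix.transpose_apply, ← V.isHermitian i j]
    exact IsCMField.complexConj_apply_apply L (V.Hm i j)
  signature_ι₁ := by
    have hmap : V.Hmᵀ.map ι₀ = V.Hm.map ι₁ := by
      ext i j
      simp only [Matrix.map_apply, Matrix.transpose_apply]
      exact V.apply_transpose_eq h i j
    rw [hmap]
    exact V.signature_ι₁
  posDef_of_ne τ hτ := by
    have hτ' : InfinitePlace.mk τ ≠ InfinitePlace.mk ι₁ := by
      subst h
      rwa [mk_conjugate_eq]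
    rw [Matrix.transpose_map]
    exact (V.posDef_of_ne τ hτ').transpose

/-- (Ported verbatim from the HodgeCMPerL package; no docstring in the source.) -/
@[simp] theorem transposeAt_Hm (V : HermSpace3 L ι₁) (h : conjugate ι₀ = ι₁) :
    (V.transposeAt ι₀ h).Hm = V.Hmᵀ := rfl

/-- (Ported verbatim from the HodgeCMPerL package; no docstring in the source.) -/
theorem map_transposeAt (V : HermSpace3 L ι₁) (h : conjugate ι₀ = ι₁) :
    (V.transposeAt ι₀ h).Hm.map ι₀ = V.Hm.map ι₁ := by
  ext i j
  simp only [transposeAt_Hm, Matrix.map_apply, Matrix.transpose_apply]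
  exact V.apply_transpose_eq h i j

/-- `Hm` read through complex conjugation of `L` is `Hmᵀ`. -/
theorem map_conjAut (V : HermSpace3 L ι₁) : V.Hm.map (conjAut L) = V.Hmᵀ := by
  ext i j
  simp only [Matrix.map_apply, Matrix.transpose_apply]
  exact V.isHermitian i j

end HermSpace3

/-! ### The conjugate level on the transposed space -/

namespace Level

variable {L : CMField} {ι₀ ι₁ : L →+* ℂ} {V : HermSpace3 L ι₁}

/-- `c_L(Γ)` is a congruence subgroup of `U(Hmᵀ)`. -/
theorem isCongruence_conj (Γ : Level V) :
    IsCongruenceSubgroup (conjRingHomK L) V.Hmᵀ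
      (Γ.Γ.map (Matrix.GeneralLinearGroup.map (conjAut L).toRingHom)) := by
  have h := isCongruenceSubgroup_map (conjAut L) (σL := conjRingHomK L) (σE := conjRingHomK L)
    (fun x ↦ rfl) V.Hm Γ.isCongruence
  rwa [show V.Hm.map (conjAut L) = V.Hmᵀ from V.map_conjAut] at h

/-- `c_L(Γ)` is torsion free. -/
theorem torsionFree_conj (Γ : Level V) :
    ∀ γ ∈ Γ.Γ.map (Matrix.GeneralLinearGroup.map (conjAut L).toRingHom), IsOfFinOrder γ → γ = 1 :=
  torsionFree_map (conjAut L) Γ.torsionFree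

/-- **The conjugate level** `c_L(Γ)` of the transposed space (born as a pair by `Level.ofCongruence`). -/
def conjTransposeAt (Γ : Level V) (ι₀ : L →+* ℂ) (h : conjugate ι₀ = ι₁) : Level (V.transposeAt ι₀ h) :=
  Level.ofCongruence (Γ.Γ.map (Matrix.GeneralLinearGroup.map (conjAut L).toRingHom))
    Γ.isCongruence_conj Γ.torsionFree_conj

/-- (Ported verbatim from the HodgeCMPerL package; no docstring in the source.) -/
@[simp] theorem Γ_conjTransposeAt (Γ : Level V) (h : conjugate ι₀ = ι₁) :
    (Γ.conjTransposeAt ι₀ h).Γ = Γ.Γ.map (Matrix.GeneralLinearGroup.map (conjAut L).toRingHom) := rfl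

end Level

/-! ### Picard codes forget the presentation -/

namespace Model

open Literature.NumberTheory.Automorphic.PicardCM Literature.AlgebraicGeometry.HodgeTheory

/-- Injectivity of `GL₃(E) → GL₃(ℂ)` for a subfield `E ⊂ ℂ`. -/
theorem glMap_subtype_injective (E : Subfield ℂ) :
    Function.Injective (Matrix.GeneralLinearGroup.map (n := Fin 3) (E.subtype : E →+* ℂ)) := by
  intro g₁ g₂ h
  refine Matrix.GeneralLinearGroup.ext fun i j ↦ Subtype.val_injective ?_
  have := congrArg (fun g : GL (Fin 3) ℂ ↦ (g : Matrix (Fin 3) (Fin 3) ℂ) i j) h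
  simpa [Matrix.GeneralLinearGroup.map_apply] using this

/-- Two Picard codes with the same subfield, the same Gram matrix read in `ℂ` and the same group read in
`GL₃(ℂ)` are equal. -/
theorem picardCode_ext {c₁ c₂ : PicardCode} (hE : c₁.E = c₂.E)
    (hH : c₁.H.map c₁.E.subtype = c₂.H.map c₂.E.subtype)
    (hΓ : c₁.Γ.map (Matrix.GeneralLinearGroup.map (c₁.E.subtype : c₁.E →+* ℂ)) =
      c₂.Γ.map (Matrix.GeneralLinearGroup.map (c₂.E.subtype : c₂.E →+* ℂ))) : c₁ = c₂ := by
  rcases c₁ with @⟨E₁, i₁, k₁, H₁, Γ₁, a₁, b₁, d₁, f₁, g₁⟩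
  rcases c₂ with @⟨E₂, i₂, k₂, H₂, Γ₂, a₂, b₂, d₂, f₂, g₂⟩
  dsimp only at hE hH hΓ
  subst hE
  obtain rfl : H₁ = H₂ := Matrix.map_injective Subtype.val_injective hH
  obtain rfl : Γ₁ = Γ₂ := Subgroup.map_injective (glMap_subtype_injective E₁) hΓ
  rfl

variable {L : CMField} {ι₀ ι₁ : L →+* ℂ}

/-- (Ported verbatim from the HodgeCMPerL package; no docstring in the source.) -/
theorem comp_conjAut_eq (h : conjugate ι₀ = ι₁) : ι₀.comp (conjAut L).toRingHom = ι₁ := by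
  rw [comp_conjAut, h]

/-- (Ported verbatim from the HodgeCMPerL package; no docstring in the source.) -/
theorem fieldRange_eq (h : conjugate ι₀ = ι₁) : ι₀.fieldRange = ι₁.fieldRange := by
  subst h
  ext x
  simp only [RingHom.mem_fieldRange]
  constructor
  · rintro ⟨y, rfl⟩
    refine ⟨conjAut L y, ?_⟩
    rw [← comp_conjAut]
    change ι₀ (conjAut L (conjAut L y)) = ι₀ y
    rw [conjAut_conjAut]
  · rintro ⟨y, rfl⟩
    exact ⟨conjAut L y, by rw [← comp_conjAut]; rfl⟩

/-- **The Picard code forgets the presentation**: `(L, ι₀, Hmᵀ, c_L Γ)` and `(L, ι₁, Hm, Γ)` with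
`conjugate ι₀ = ι₁` have the same code (same subfield `ι₀(L) = ι₁(L)`, same Gram matrix and group read in `ℂ`). -/
theorem pmsCode_transposeAt (V : HermSpace3 L ι₁) (Γ : Level V) (ι₀ : L →+* ℂ) (h : conjugate ι₀ = ι₁) :
    pmsCode L ι₀ (V.transposeAt ι₀ h) (Γ.conjTransposeAt ι₀ h) = pmsCode L ι₁ V Γ := by
  refine picardCode_ext (fieldRange_eq h) ?_ ?_
  · change (PicardCode.ofHermitian ι₀ _ _ _ _ _ _ _).H.map ι₀.fieldRange.subtype =
      (PicardCode.ofHermitian ι₁ _ _ _ _ _ _ _).H.map ι₁.fieldRange.subtype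
    rw [PicardCode.ofHermitian_H_map, PicardCode.ofHermitian_H_map]
    exact V.map_transposeAt h
  · change (PicardCode.ofHermitian ι₀ _ _ _ _ _ _ _).Γ.map
        (Matrix.GeneralLinearGroup.map (ι₀.fieldRange.subtype : ι₀.fieldRange →+* ℂ)) =
      (PicardCode.ofHermitian ι₁ _ _ _ _ _ _ _).Γ.map
        (Matrix.GeneralLinearGroup.map (ι₁.fieldRange.subtype : ι₁.fieldRange →+* ℂ))
    rw [PicardCode.ofHermitian_Γ_map, PicardCode.ofHermitian_Γ_map, Level.Γ_conjTransposeAt,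
      Subgroup.map_map, ← Matrix.GeneralLinearGroup.map_comp, comp_conjAut_eq h]

/-! ### The theorem -/

variable (hHD : exists_isReal_hodgeModel) (hI : hodgePQ_independent_of_hodgeModel)
  (hU : BallQuotientUniformisedDatum) (h₃ : CMAbelianVarietyRealised)

/-- The model's source surface does not see the re-presentation. -/
theorem universeOf_pms_transposeAt (V : HermSpace3 L ι₁) (Γ : Level V) (ι₀ : L →+* ℂ)
    (h : conjugate ι₀ = ι₁) :
    (universeOf hHD hI hU h₃).pms L ι₀ (V.transposeAt ι₀ h) (Γ.conjTransposeAt ι₀ h) =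
      (universeOf hHD hI hU h₃).pms L ι₁ V Γ := by
  rw [universeOf_pms, universeOf_pms, pmsCode_transposeAt]

/-- **`PerL` from `PerL` at canonical representatives, for the model universe** (KERNEL; no conjugate
varieties): off the representative, pass to `ι₁ := conjugate ι₀ = (mk ι₀).embedding` and `j′ := c_L ∘ j`,
apply the hypothesis there, and re-present the surface by `(Hmᵀ, c_L Γ)` at `ι₀` — the same `Var`. -/
theorem perL_of_perLCanonical (hcan : (universeOf hHD hI hU h₃).PerLCanonical) :
    (universeOf hHD hI hU h₃).PerL := by
  intro K L j hN h6 h24 φ hφ ι₀ hι t ht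
  rcases InfinitePlace.embedding_mk_eq ι₀ with hc | hc
  · exact hcan K L j hN h6 h24 φ hφ ι₀ hι hc t ht
  · -- `hc : (mk ι₀).embedding = conjugate ι₀`
    have hrep : (InfinitePlace.mk (conjugate ι₀)).embedding = conjugate ι₀ := by
      rw [mk_conjugate_eq, hc]
    have hj : (conjugate ι₀).comp ((conjAut L).toRingHom.comp j) = φ 0 := by
      rw [← RingHom.comp_assoc, comp_conjAut, ComplexEmbedding.involutive_conjugate]
      exact hι
    obtain ⟨V, Γ, hP⟩ := hcan K L ((conjAut L).toRingHom.comp j) hN h6 h24 φ hφ (conjugate ι₀) hj hrep t ht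
    exact ⟨V.transposeAt ι₀ rfl, Universe.periodNV_of_pms_eq _ (Γ.conjTransposeAt ι₀ rfl) Γ
      (universeOf_pms_transposeAt hHD hI hU h₃ V Γ ι₀ rfl) hP⟩

/-- **`PerL` from `PerL44` at canonical representatives, for the model universe** (the shape an oriented
E core delivers: `RealisationExists…Canonical → PerL44Canonical`, then this). -/
theorem perL_of_perL44Canonical (hL : Universe.LandherrExists)
    (h44 : (universeOf hHD hI hU h₃).PerL44Canonical) : (universeOf hHD hI hU h₃).PerL :=
  perL_of_perLCanonical hHD hI hU h₃ ((universeOf hHD hI hU h₃).perLCanonical_of_perL44Canonical hL h44)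

/-- The same, as an equivalence. -/
theorem perL_iff_perLCanonical :
    (universeOf hHD hI hU h₃).PerL ↔ (universeOf hHD hI hU h₃).PerLCanonical :=
  ⟨(universeOf hHD hI hU h₃).perLCanonical_of_perL, perL_of_perLCanonical hHD hI hU h₃⟩

/-- **On the end-state universe `picardCMUniverse`** (binder-level corollary; `picardCMUniverse … :=
universeOf hHD hI (ballQuotientUniformisedDatum_of h₁) h₃` by `rfl`). -/
theorem perL_picardCM_of_perLCanonical (h₁ : BallQuotientUniformised)
    (hcan : (picardCMUniverse hHD hI h₁ h₃).PerLCanonical) :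
    (picardCMUniverse hHD hI h₁ h₃).PerL :=
  perL_of_perLCanonical hHD hI _ h₃ hcan

end Model

end HodgeCM

end
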